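import Summits.AtomisticToContinuum.Crystallization.Theses.GscTwinLoopSurgery
import Summits.AtomisticToContinuum.Crystallization.Theorems.GscTwinLoopSurgeryLocalLimitStableField
import Literature.MathematicalPhysics.StatisticalMechanics.LocalLimitOfGroundStates
import Literature.MathematicalPhysics.StatisticalMechanics.HardCoreGSC

/-!
# `LocalLimitStable` (stmt-AtomisticToContinuum-14086): local limits of translated
# Lennard-Jones ground states are hard-core canonical ground state configurations

Closing file for the support item `GscTwinLoopSurgery.LocalLimitStable` of route
`AtomisticToContinuum/Crystallization/GscTwinLoopSurgery`: every `X ∈ 𝔏`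
(`IsLocalLimitOfGroundStates lennardJones 3 X`: a translated subsequence `x^(σ j) + τ_j` of
Lennard-Jones ground states is, for every radius and every tolerance, eventually two-way matched
with `X` on the ball) is a hard-core canonical GSC (`IsHardCoreGSC lennardJones X`, Sütő 2011
§7 Definition 7.1 in the distinct-points convention): no exchange of finitely many points `y` of
`X` for as many distinct new points `z` off `X ∖ y` lowers
`interactionEnergy + field of the rest` (`isHardCoreGSC_of_isLocalLimitOfGroundStates`,
`localLimitStable_proof`).

MECHANISM (Radin 1987 / Bellissard–Radin–Shlosman 2010: limits of finite-volume ground states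
are ground state configurations; here the Lennard-Jones transplant on the tree's carriers).  The
point set `W_j` of the `j`-th translated ground state is itself a hard-core GSC
(`IsGroundState.isHardCoreGSC_range_of_le` of the tree).  Let `y'_j i` be THE particle of `W_j`
within `δ/2` of `y i` (`δ` the uniform minimal distance, `LennardJonesMinimalDistance_holds`);
eventually `y'_j` is injective, `z` avoids `W_j ∖ y'_j`, and the rests `W_j ∖ y'_j` are two-way
matched with `X ∖ y` about every centre.  The stability inequality of `W_j` under `y'_j ↦ z`
passes to the limit `j → ∞`: `𝓔(y'_j) → 𝓔(y)` (continuity of `V_LJ` off `0`) and the field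
sums converge by `tendsto_sum_lennardJones_of_matched` (helpers I: uniform `r⁻⁶` tails of
separated configurations, packing, modulus of continuity).  All `[folklore]`.
-/

noncomputable section

open scoped BigOperators Topology
open Filter Set Metric

namespace Summit.AtomisticToContinuum.Crystallization.Theorems.LocalLimitStable

open Literature.MathematicalPhysics.StatisticalMechanics

open Summit.AtomisticToContinuum.Crystallization.Theorems.ChargedEnergyGapNegative (E3)

/-- `‖p‖ ≤ dist p w + ‖w‖`. [folklore] -/
theorem norm_le_dist_add_norm (p w : E3) : ‖p‖ ≤ dist p w + ‖w‖ := by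
  have h := dist_triangle p w 0
  rwa [dist_zero_right, dist_zero_right] at h

/-- **Local limits of translated Lennard-Jones ground states are hard-core canonical GSCs**
(Sütő 2011 §7 Definition 7.1, distinct-points convention; the existence mechanism of
Radin 1987 / Bellissard–Radin–Shlosman 2010 for Lennard-Jones in `ℝ³`): if `X ∈ 𝔏` then for
`n` distinct points `y` of `X` and `n` distinct new positions `z` avoiding `X ∖ y`,
`𝓔(y) + Σᵢ Σ'_{q ∈ X∖y} V_LJ(|yᵢ − q|) ≤ 𝓔(z) + Σᵢ Σ'_{q ∈ X∖y} V_LJ(|zᵢ − q|)`.  Transplant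
the exchange to the `j`-th translated ground state (a hard-core GSC of its own point set) with
`y` replaced by the matched particles `y'_j`, and pass to the limit. [folklore] -/
theorem isHardCoreGSC_of_isLocalLimitOfGroundStates {X : Set E3}
    (hX : IsLocalLimitOfGroundStates lennardJones 3 X) : IsHardCoreGSC lennardJones X := by
  classical
  obtain ⟨δ, hδ, hsep⟩ := LennardJonesMinimalDistance_holds
  have hXsep : ∀ p ∈ X, ∀ q ∈ X, p ≠ q → δ ≤ dist p q := fun p hp q hq hpq =>
    hX.le_dist hsep hp hq hpq
  obtain ⟨x, σ, τ, hgs, -, hlim⟩ := hX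
  -- the translated ground states, their separation and their stability
  set W : (j : ℕ) → Fin (σ j) → E3 := fun j k => x (σ j) k + τ j with hW
  have hWsep : ∀ j k l, k ≠ l → δ ≤ dist (W j k) (W j l) := fun j k l hkl => by
    simp only [hW, dist_add_right]
    exact hsep _ _ (hgs _) k l hkl
  have hWgsc : ∀ j, IsHardCoreGSC lennardJones (Set.range (W j)) := fun j => by
    have h := ((hgs (σ j)).isHardCoreGSC_range_of_le lennardJones
      neg_one_div_le_lennardJones).image_add_const (τ j)
    simpa only [← Set.range_comp, Function.comp_def] using h
  intro n y z hy hz hyX hdisj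
  -- the matched particles `y' j i`: the particle of `W j` within `δ/2` of `y i`, if any
  have hpick : ∀ (j : ℕ) (i : Fin n), ∃ q : E3, (∃ k, dist (W j k) (y i) < δ / 2) →
      q ∈ Set.range (W j) ∧ dist q (y i) < δ / 2 := fun j i => by
    by_cases h : ∃ k, dist (W j k) (y i) < δ / 2
    · obtain ⟨k, hk⟩ := h
      exact ⟨W j k, fun _ => ⟨Set.mem_range_self k, hk⟩⟩
    · exact ⟨y i, fun h' => absurd h' h⟩
  choose y' hy' using hpick
  have hy'ε : ∀ (j : ℕ) (i : Fin n) (ε : ℝ), ε < δ / 2 → (∃ k, dist (W j k) (y i) ≤ ε) →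
      y' j i ∈ Set.range (W j) ∧ dist (y' j i) (y i) ≤ ε := by
    intro j i ε hε hk
    obtain ⟨k, hk⟩ := hk
    obtain ⟨hmem, hlt⟩ := hy' j i ⟨k, hk.trans_lt hε⟩
    refine ⟨hmem, ?_⟩
    obtain ⟨k', hk'⟩ := hmem
    by_contra hne
    have hkk : k' ≠ k := fun h => hne (by rw [← hk', h]; exact hk)
    have h1 := hWsep j k' k hkk
    have h2 := dist_triangle_right (W j k') (W j k) (y i)
    rw [hk'] at h1 h2
    linarith
  -- the rests `S j = W j ∖ y' j`
  set S : ℕ → Finset E3 := fun j => Finset.univ.image (W j) \ Finset.univ.image (y' j) with hS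
  have hSmem : ∀ j p, p ∈ S j ↔ (∃ k, W j k = p) ∧ ¬ ∃ i, y' j i = p := fun j p => by
    simp only [hS, Finset.mem_sdiff, Finset.mem_image, Finset.mem_univ, true_and]
  have hScoe : ∀ j, (↑(S j) : Set E3) = Set.range (W j) \ Set.range (y' j) := fun j => by
    ext p
    simp only [Finset.mem_coe, hSmem, Set.mem_sdiff, Set.mem_range]
  have hSsep : ∀ j, ∀ p ∈ S j, ∀ q ∈ S j, p ≠ q → δ ≤ dist p q := by
    intro j p hp q hq hpq
    obtain ⟨⟨k, rfl⟩, -⟩ := (hSmem j p).1 hp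
    obtain ⟨⟨l, rfl⟩, -⟩ := (hSmem j _).1 hq
    exact hWsep j k l fun h => hpq (h ▸ rfl)
  -- (ev1) eventually every `y i` is matched
  set Ry : ℝ := ∑ k, ‖y k‖ with hRy
  have hyR : ∀ i, ‖y i‖ ≤ Ry := fun i =>
    Finset.single_le_sum (f := fun k => ‖y k‖) (fun _ _ => norm_nonneg _) (Finset.mem_univ i)
  have ev1 : ∀ ε : ℝ, 0 < ε → ε < δ / 2 → ∀ᶠ j in atTop, ∀ i,
      y' j i ∈ Set.range (W j) ∧ dist (y' j i) (y i) ≤ ε := by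
    intro ε hε hεδ
    filter_upwards [hlim Ry ε hε] with j hj
    intro i
    obtain ⟨k, hk⟩ := hj.1 (y i) (hyX (Set.mem_range_self i)) (hyR i)
    exact hy'ε j i ε hεδ ⟨k, hk⟩
  have hδ4 : (0 : ℝ) < δ / 4 := by positivity
  have hδ42 : δ / 4 < δ / 2 := by linarith
  -- (ev2) eventually `y' j` is injective
  have ev2 : ∀ᶠ j in atTop, Function.Injective (y' j) := by
    filter_upwards [ev1 (δ / 4) hδ4 hδ42] with j hj
    intro i i' hii'
    by_contra hne
    have h1 := hXsep _ (hyX (Set.mem_range_self i)) _ (hyX (Set.mem_range_self i'))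
      (fun h => hne (hy h))
    have h2 := dist_triangle (y i) (y' j i) (y i')
    have hi := (hj i).2
    have hi' := (hj i').2
    rw [hii'] at hi h2
    rw [dist_comm] at hi
    linarith
  -- (ev3) eventually the matched particles are particles
  have ev3 : ∀ᶠ j in atTop, Set.range (y' j) ⊆ Set.range (W j) := by
    filter_upwards [ev1 (δ / 4) hδ4 hδ42] with j hj
    rintro _ ⟨i, rfl⟩
    exact (hj i).1
  -- (ev4) eventually the new positions avoid the rest
  have ev4 : ∀ᶠ j in atTop, Disjoint (Set.range z) (Set.range (W j) \ Set.range (y' j)) := by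
    have key : ∀ i, ∀ᶠ j in atTop, z i ∉ Set.range (W j) \ Set.range (y' j) := by
      intro i
      by_cases hzi : z i ∈ Set.range y
      · obtain ⟨i₀, hi₀⟩ := hzi
        filter_upwards [ev1 (δ / 4) hδ4 hδ42] with j hj
        rintro ⟨⟨k, hk⟩, hnot⟩
        obtain ⟨⟨k', hk'⟩, hyi⟩ := hj i₀
        apply hnot
        refine ⟨i₀, ?_⟩
        by_contra hne
        have hkk : k' ≠ k := fun h => hne (by rw [← hk', h, hk])
        have h1 := hWsep j k' k hkk
        rw [hk', hk] at h1
        rw [hi₀] at hyi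
        linarith
      · have hzX : z i ∉ X := fun h =>
          (Set.disjoint_left.1 hdisj (Set.mem_range_self i)) ⟨h, hzi⟩
        obtain ⟨ρ₀, hρ₀, hρ⟩ := exists_pos_le_dist_of_not_mem hδ hXsep hzX
        filter_upwards [hlim ‖z i‖ (ρ₀ / 2) (by positivity)] with j hj
        rintro ⟨⟨k, hk⟩, -⟩
        obtain ⟨p, hpX, hkp⟩ := hj.2 k (by rw [← hk])
        have := hρ p hpX
        rw [← hk] at this
        linarith
    filter_upwards [Filter.eventually_all.2 key] with j hj
    exact Set.disjoint_left.2 (by rintro _ ⟨i, rfl⟩ hq; exact hj i hq)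
  -- (ev5) eventually the rests are two-way matched with `X ∖ y` about any centre
  have ev5 : ∀ (w₀ : E3) (R ε : ℝ), 0 < ε → ∀ᶠ j in atTop,
      (∀ p ∈ X \ Set.range y, dist p w₀ ≤ R → ∃ q ∈ S j, dist q p ≤ ε) ∧
        (∀ q ∈ S j, dist q w₀ ≤ R → ∃ p ∈ X \ Set.range y, dist q p ≤ ε) := by
    intro w₀ R ε hε
    set ε₁ : ℝ := min ε (δ / 4) with hε₁
    have hε₁0 : 0 < ε₁ := lt_min hε hδ4
    have hε₁ε : ε₁ ≤ ε := min_le_left _ _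
    have hε₁δ : ε₁ ≤ δ / 4 := min_le_right _ _
    filter_upwards [hlim (R + ‖w₀‖) ε₁ hε₁0, ev1 ε₁ hε₁0 (hε₁δ.trans_lt hδ42)] with j hj hj1
    obtain ⟨hA, hB⟩ := hj
    constructor
    · rintro p ⟨hpX, hpy⟩ hpR
      obtain ⟨k, hk⟩ := hA p hpX (by linarith [norm_le_dist_add_norm p w₀])
      refine ⟨W j k, (hSmem j _).2 ⟨⟨k, rfl⟩, ?_⟩, hk.trans hε₁ε⟩
      rintro ⟨i, hi⟩
      obtain ⟨-, hyi⟩ := hj1 i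
      have hne : y i ≠ p := fun h => hpy ⟨i, h⟩
      have h1 := hXsep _ (hyX (Set.mem_range_self i)) _ hpX hne
      have h2 := dist_triangle (y i) (y' j i) p
      rw [hi] at hyi h2
      rw [dist_comm] at hyi
      have h3 : dist (W j k) p ≤ ε₁ := hk
      linarith
    · intro q hq hqR
      obtain ⟨⟨k, rfl⟩, hqy⟩ := (hSmem j q).1 hq
      obtain ⟨p, hpX, hkp⟩ := hB k (by linarith [norm_le_dist_add_norm (W j k) w₀])
      refine ⟨p, ⟨hpX, ?_⟩, hkp.trans hε₁ε⟩
      rintro ⟨i, rfl⟩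
      obtain ⟨⟨k', hk'⟩, hyi⟩ := hj1 i
      apply hqy
      refine ⟨i, ?_⟩
      by_contra hne
      have hkk : k' ≠ k := fun h => hne (by rw [← hk', h])
      have h1 := hWsep j k' k hkk
      rw [hk'] at h1
      have h2 := dist_triangle (y' j i) (y i) (W j k)
      rw [dist_comm (y i) (W j k)] at h2
      have h3 : dist (W j k) (y i) ≤ ε₁ := hkp
      linarith
  -- (ev6) eventually: the stability inequality of `W j` under `y' j ↦ z`
  have ev6 : ∀ᶠ j in atTop,
      interactionEnergy lennardJones (y' j) + ∑ i, ∑ q ∈ S j, lennardJones (dist (y' j i) q) ≤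
        interactionEnergy lennardJones z + ∑ i, ∑ q ∈ S j, lennardJones (dist (z i) q) := by
    filter_upwards [ev2, ev3, ev4] with j h2 h3 h4
    have key := (hWgsc j).le h2 hz h3 h4
    have hconv : ∀ w : E3, ∑' q : ↥(Set.range (W j) \ Set.range (y' j)),
        lennardJones (dist w q) = ∑ q ∈ S j, lennardJones (dist w q) := fun w => by
      rw [tsum_congr_set_coe (fun q => lennardJones (dist w q)) (hScoe j).symm,
        Finset.tsum_subtype' (S j) (fun q => lennardJones (dist w q))]
    simpa only [hconv] using key
  -- (E7) the limits
  have limy' : ∀ i, Tendsto (fun j => y' j i) atTop (𝓝 (y i)) := by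
    intro i
    rw [Metric.tendsto_nhds]
    intro ε hε
    have hε' : 0 < min (ε / 2) (δ / 4) := lt_min (by positivity) hδ4
    filter_upwards [ev1 (min (ε / 2) (δ / 4)) hε' ((min_le_right _ _).trans_lt hδ42)]
      with j hj
    have h1 := (hj i).2
    have h2 := min_le_left (ε / 2) (δ / 4)
    linarith
  have limE : Tendsto (fun j => interactionEnergy lennardJones (y' j)) atTop
      (𝓝 (interactionEnergy lennardJones y)) := by
    unfold interactionEnergy
    refine tendsto_finsetSum _ fun i _ => tendsto_finsetSum _ fun k hk => ?_
    have hik : i ≠ k := (Finset.mem_Ioi.1 hk).ne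
    have hne : dist (y i) (y k) ∈ ({0}ᶜ : Set ℝ) := by
      simp only [Set.mem_compl_iff, Set.mem_singleton_iff]
      exact dist_ne_zero.2 fun h => hik (hy h)
    have hcont : ContinuousAt lennardJones (dist (y i) (y k)) :=
      continuousOn_lennardJones.continuousAt (isOpen_compl_singleton.mem_nhds hne)
    exact hcont.tendsto.comp ((limy' i).dist (limy' k))
  have hX'sep : ∀ p ∈ X \ Set.range y, ∀ q ∈ X \ Set.range y, p ≠ q → δ ≤ dist p q :=
    fun p hp q hq hpq => hXsep p hp.1 q hq.1 hpq
  have limFy : ∀ i, Tendsto (fun j => ∑ q ∈ S j, lennardJones (dist (y' j i) q)) atTop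
      (𝓝 (∑' q : ↥(X \ Set.range y), lennardJones (dist (y i) q))) := fun i =>
    tendsto_sum_lennardJones_of_matched hδ hX'sep hδ
      (fun q hq => hXsep _ (hyX (Set.mem_range_self i)) _ hq.1 fun h => hq.2 ⟨i, h⟩)
      hSsep (limy' i) (ev5 (y i))
  have limFz : ∀ i, Tendsto (fun j => ∑ q ∈ S j, lennardJones (dist (z i) q)) atTop
      (𝓝 (∑' q : ↥(X \ Set.range y), lennardJones (dist (z i) q))) := fun i => by
    obtain ⟨ρ₀, hρ₀, hρ⟩ := exists_pos_le_dist_of_not_mem hδ hX'sep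
      (Set.disjoint_left.1 hdisj (Set.mem_range_self i))
    exact tendsto_sum_lennardJones_of_matched hδ hX'sep hρ₀ hρ hSsep tendsto_const_nhds
      (ev5 (z i))
  exact le_of_tendsto_of_tendsto (limE.add (tendsto_finsetSum _ fun i _ => limFy i))
    (tendsto_const_nhds.add (tendsto_finsetSum _ fun i _ => limFz i)) ev6

/-- **`LocalLimitStable`** (item stmt-AtomisticToContinuum-14086 of route `GscTwinLoopSurgery`,
exactly as printed there): every local limit `X ∈ 𝔏` of translated Lennard-Jones ground states
is a hard-core canonical ground state configuration — the route's inline clauses are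
`IsLocalLimitOfGroundStates lennardJones 3 X` and `IsHardCoreGSC lennardJones X` by `Iff.rfl`.
[folklore] -/
theorem localLimitStable_proof :
    Summit.AtomisticToContinuum.Crystallization.Theses.GscTwinLoopSurgery.LocalLimitStable :=
  fun _ hX => isHardCoreGSC_of_isLocalLimitOfGroundStates hX

end Summit.AtomisticToContinuum.Crystallization.Theorems.LocalLimitStable

end
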